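import Literature.GroupTheory.CombinatorialGroupTheory.RibbonGraphGeometricBasisMerge
import HarnessLib

/-!
# Geometric free bases of one-vertex ribbon graphs: the SPLIT step

Topic `Literature/GroupTheory/CombinatorialGroupTheory`; continues
`RibbonGraphGeometricBasisMerge.lean`.  Let `e` be an edge of the one-vertex ribbon graph `(E, ρ)`
whose two darts lie on the SAME boundary cycle (word `e · U · e⁻¹ · V`), so that deleting `e`
SPLITS it into two boundary cycles with words `U`, `V`.  From a geometric basis of
`(E ∖ {e}, delRot ρ e)` in which the `V`-cycle is the LAST one and the `U`-cycle is the free slot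
`a` (with generator `C_a`), we build a geometric basis of `(E, ρ)` with ONE MORE HANDLE
`(X C_a X⁻¹, X W E X⁻¹)` — where `E := σ_b · e · σ_a⁻¹` is a Nielsen image of the fresh letter,
`X = C_0 ⋯ C_{a-1}`, `W = C_{a+1} ⋯ C_m` — and the free slots `C_k`, `k ≠ a`
(`GeometricBasis.splitStep`); the merged boundary cycle is the new last one.  The identity behind
it: `X C_a W · E C_a⁻¹ E⁻¹ = [X C_a X⁻¹, X W E X⁻¹] · X W`.  Genus `g ↦ g + 1`, `m + 1 ↦ m`.
-/

namespace Literature.GroupTheory.CombinatorialGroupTheory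

namespace RibbonGraph

open Equiv Equiv.Perm Function

universe u

/-! ### Prefix and suffix of the boundary word -/

variable {g m : ℕ} (a : Fin (m + 1))

/-- The prefix `C_0 ⋯ C_{a-1}` of the boundary word (index side). [cite: ZieschangVogtColdewey1980, Prop. 3.2.4 (canonical normal form 3.2.6)] -/
def bwPrefix (g m : ℕ) (a : Fin (m + 1)) : FreeGroup (GBIndex g (m + 1)) :=
  ((List.ofFn fun k : Fin (m + 1) => FreeGroup.of (Sum.inr k : GBIndex g (m + 1))).take a).prod

/-- The suffix `C_{a+1} ⋯ C_m` of the boundary word (index side). [cite: ZieschangVogtColdewey1980, Prop. 3.2.4 (canonical normal form 3.2.6)] -/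
def bwSuffix (g m : ℕ) (a : Fin (m + 1)) : FreeGroup (GBIndex g (m + 1)) :=
  ((List.ofFn fun k : Fin (m + 1) => FreeGroup.of (Sum.inr k : GBIndex g (m + 1))).drop (a + 1)).prod

/-- `boundaryWord_eq_prefix_mul_suffix`: bookkeeping lemma of this construction (see the module docstring). [cite: ZieschangVogtColdewey1980, Prop. 3.2.4 (canonical normal form 3.2.6)] -/
theorem boundaryWord_eq_prefix_mul_suffix :
    boundaryWord g (m + 1) = bwPrefix g m a * FreeGroup.of (Sum.inr a) * bwSuffix g m a := by
  rw [boundaryWord, bwPrefix, bwSuffix, mul_assoc, ← List.prod_cons, ← List.prod_append]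
  congr 1
  conv_lhs => rw [← List.take_append_drop (a : ℕ)
    (List.ofFn fun k : Fin (m + 1) => FreeGroup.of (Sum.inr k : GBIndex g (m + 1)))]
  congr 1
  rw [List.drop_eq_getElem_cons (by rw [List.length_ofFn]; exact a.isLt), List.getElem_ofFn]

/-- Removing slot `a` from the boundary word leaves `prefix · suffix`. [cite: ZieschangVogtColdewey1980, Prop. 3.2.4 (canonical normal form 3.2.6)] -/
theorem boundaryWord_succAbove :
    (List.ofFn fun k : Fin m => FreeGroup.of (Sum.inr (a.succAbove k) : GBIndex g (m + 1))).prod =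
      bwPrefix g m a * bwSuffix g m a := by
  rw [bwPrefix, bwSuffix, ← List.prod_append, ← List.eraseIdx_eq_take_drop_succ]
  congr 1
  apply List.ext_getElem
  · have := a.isLt
    simp [List.length_eraseIdx]
    omega
  · intro k h1 h2
    rw [List.getElem_ofFn]
    simp only [List.length_ofFn] at h1
    rw [List.getElem_eraseIdx]
    by_cases hk : k < a
    · rw [dif_pos hk, List.getElem_ofFn]
      congr 2
      rw [Fin.succAbove_of_castSucc_lt _ _ (by simpa [Fin.lt_def] using hk)]
      rfl
    · rw [dif_neg hk, List.getElem_ofFn]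
      congr 2
      rw [Fin.succAbove_of_le_castSucc _ _ (by simpa [Fin.le_def] using le_of_not_gt hk)]
      rfl

/-- `bwPrefix_mem_genAvoiding`: bookkeeping lemma of this construction (see the module docstring). [cite: ZieschangVogtColdewey1980, Prop. 3.2.4 (canonical normal form 3.2.6)] -/
theorem bwPrefix_mem_genAvoiding : bwPrefix g m a ∈ genAvoiding (Sum.inr a : GBIndex g (m + 1)) := by
  refine Subgroup.list_prod_mem _ fun x hx => ?_
  obtain ⟨k, hk, rfl⟩ := List.mem_iff_getElem.1 hx
  simp only [List.length_take, List.length_ofFn] at hk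
  rw [List.getElem_take, List.getElem_ofFn]
  exact of_mem_genAvoiding fun h => by
    have := congrArg Fin.val (Sum.inr_injective h); simp at this; omega

/-- `bwPrefix_mem_genSubgroup_compl_inl`: bookkeeping lemma of this construction (see the module docstring). [cite: ZieschangVogtColdewey1980, Prop. 3.2.4 (canonical normal form 3.2.6)] -/
theorem bwPrefix_mem_genSubgroup_compl_inl :
    bwPrefix g m a ∈ genSubgroup (Set.range (Sum.inl : Fin g × Bool → GBIndex g (m + 1)))ᶜ := by
  refine Subgroup.list_prod_mem _ fun x hx => ?_
  obtain ⟨k, hk, rfl⟩ := List.mem_iff_getElem.1 hx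
  rw [List.getElem_take, List.getElem_ofFn]
  exact of_mem_genSubgroup (by rintro ⟨_, h⟩; exact Sum.inl_ne_inr h)

variable {E : Type u} [Finite E] [DecidableEq E] {ρ : Perm (Dart E)} {e : E} {p q : ℕ}

/-! ### The split step -/

section Split

variable (hper : minimalPeriod (face ρ) (e, true) = p + q + 2)
  (hhit : (face ρ ^ (p + 1)) (e, true) = (e, false)) (hp1 : 0 < p) (hq1 : 0 < q)
  (G : GeometricBasis (delRot ρ e) g (m + 1))
  (hUa : (delFace ρ e).SameCycle (dartEmb e (G.rep a.castSucc)) (face ρ (e, true)))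
  (hVl : (delFace ρ e).SameCycle (dartEmb e (G.rep (Fin.last (m + 1)))) (face ρ (e, false)))

include hper hhit hp1 hq1 hUa hVl in
/-- The words `U`, `V`, read in the smaller ribbon graph, as conjugates of the free generator
`C_a` and of the inverse surface word. [cite: ZieschangVogtColdewey1980, Prop. 3.2.4 (canonical normal form 3.2.6)] -/
theorem split_exists_words :
    ∃ (σa σb : FreeGroup {x : E // x ≠ e}),
      prodFrom (face ρ) letter (face ρ (e, true)) p =
        (ιE e σa)⁻¹ * ιE e (G.β (FreeGroup.of (Sum.inr a))) * ιE e σa ∧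
      prodFrom (face ρ) letter (face ρ (e, false)) q =
        (ιE e σb)⁻¹ * (ιE e (G.β (surfaceWord g (m + 1))))⁻¹ * ιE e σb := by
  obtain ⟨zU, hzU⟩ := exists_dartEmb_eq e (d := face ρ (e, true))
    (by simpa using split_pow_true_fst_ne hper hhit (k := 1) le_rfl hp1)
  obtain ⟨zV, hzV⟩ := exists_dartEmb_eq e (d := face ρ (e, false))
    (by simpa using split_pow_false_fst_ne hper hhit (k := 1) le_rfl hq1)
  have hcU : (face (delRot ρ e)).SameCycle (G.rep a.castSucc) zU := by
    rw [sameCycle_face_delRot_iff, hzU]; exact hUa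
  have hcV : (face (delRot ρ e)).SameCycle (G.rep (Fin.last (m + 1))) zV := by
    rw [sameCycle_face_delRot_iff, hzV]; exact hVl
  obtain ⟨cU, hcU'⟩ := exists_cycleProd_eq_conj_of_sameCycle (face (delRot ρ e)) letter hcU
  obtain ⟨cV, hcV'⟩ := exists_cycleProd_eq_conj_of_sameCycle (face (delRot ρ e)) letter hcV
  refine ⟨G.t a.castSucc * cU, G.t (Fin.last (m + 1)) * cV, ?_, ?_⟩
  · have h1 : ιE e (cycleProd (face (delRot ρ e)) letter zU) = prodFrom (face ρ) letter (face ρ (e, true)) p := by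
      rw [map_cycleProd_face_delRot, hzU, cycleProd, split_minimalPeriod_true hper hhit hp1,
        split_prodFrom_true hper hhit]
    have h2 : cycleProd (face (delRot ρ e)) letter (G.rep a.castSucc) =
        (G.t a.castSucc)⁻¹ * G.β (FreeGroup.of (Sum.inr a)) * G.t a.castSucc := by
      rw [← G.free_eq a]; group
    rw [← h1, hcU', h2]; simp only [map_mul, map_inv]; group
  · have h1 : ιE e (cycleProd (face (delRot ρ e)) letter zV) = prodFrom (face ρ) letter (face ρ (e, false)) q := by
      rw [map_cycleProd_face_delRot, hzV, cycleProd, split_minimalPeriod_false hper hhit hq1,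
        split_prodFrom_false hper hhit]
    have h2 : cycleProd (face (delRot ρ e)) letter (G.rep (Fin.last (m + 1))) =
        (G.t (Fin.last (m + 1)))⁻¹ * (G.β (surfaceWord g (m + 1)))⁻¹ * G.t (Fin.last (m + 1)) := by
      rw [← G.last_eq]; group
    rw [← h1, hcV', h2]; simp only [map_mul, map_inv]; group

/-- Conjugating the free generator `c_a` by the prefix `c_0 ⋯ c_{a-1}` (index side).
[cite: ZieschangVogtColdewey1980, Prop. 3.2.4 (canonical normal form 3.2.6)] -/
noncomputable def splitConjAut (g m : ℕ) (a : Fin (m + 1)) : MulAut (FreeGroup (GBIndex g (m + 1))) :=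
  conjGensAut ({Sum.inr a} : Set (GBIndex g (m + 1))) (bwPrefix g m a)
    (by simpa [genAvoiding, Set.compl_def] using bwPrefix_mem_genAvoiding (g := g) a)

/-- `splitConjAut_of_inr_self`: bookkeeping lemma of this construction (see the module docstring). [cite: ZieschangVogtColdewey1980, Prop. 3.2.4 (canonical normal form 3.2.6)] -/
theorem splitConjAut_of_inr_self :
    splitConjAut g m a (FreeGroup.of (Sum.inr a)) =
      bwPrefix g m a * FreeGroup.of (Sum.inr a) * (bwPrefix g m a)⁻¹ :=
  conjGensAut_of_mem _ _ rfl

/-- `splitConjAut_of_ne`: bookkeeping lemma of this construction (see the module docstring). [cite: ZieschangVogtColdewey1980, Prop. 3.2.4 (canonical normal form 3.2.6)] -/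
theorem splitConjAut_of_ne {j : GBIndex g (m + 1)} (hj : j ≠ Sum.inr a) :
    splitConjAut g m a (FreeGroup.of j) = FreeGroup.of j :=
  conjGensAut_of_not_mem _ _ hj

/-- `splitConjAut_eq_self_of_mem`: bookkeeping lemma of this construction (see the module docstring). [cite: ZieschangVogtColdewey1980, Prop. 3.2.4 (canonical normal form 3.2.6)] -/
theorem splitConjAut_eq_self_of_mem {x : FreeGroup (GBIndex g (m + 1))}
    (hx : x ∈ genAvoiding (Sum.inr a : GBIndex g (m + 1))) : splitConjAut g m a x = x :=
  conjGensAut_eq_self_of_mem _ _ (by simpa [genAvoiding, Set.compl_def] using hx)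

/-- The fresh-letter move of the split step on `F((E ∖ {e}) ⊔ ⋆)`:
`⋆ ↦ (X W σ_b) ⋆ (σ_a⁻¹ X⁻¹)`. [cite: ZieschangVogtColdewey1980, Prop. 3.2.4 (canonical normal form 3.2.6)] -/
noncomputable def splitAut (XW X σa σb : FreeGroup {x : E // x ≠ e}) :
    MulAut (FreeGroup ({x : E // x ≠ e} ⊕ Unit)) :=
  mulGenAut (Sum.inr ()) (FreeGroup.map Sum.inl (XW * σb)) (FreeGroup.map Sum.inl (σa⁻¹ * X⁻¹))
    (map_inl_mem_genAvoiding _ _) (map_inl_mem_genAvoiding _ _)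

/-- The new free basis of the split step. [cite: ZieschangVogtColdewey1980, Prop. 3.2.4 (canonical normal form 3.2.6)] -/
noncomputable def splitBasis (G : GeometricBasis (delRot ρ e) g (m + 1)) (a : Fin (m + 1))
    (σa σb : FreeGroup {x : E // x ≠ e}) : FreeGroup (GBIndex (g + 1) m) ≃* FreeGroup E :=
  (FreeGroup.freeGroupCongr (splitIndexEquiv g m a)).trans
    ((sumCongrLeft ((splitConjAut g m a).trans G.β)).trans
      ((splitAut (G.β (bwPrefix g m a * bwSuffix g m a)) (G.β (bwPrefix g m a)) σa σb).trans
        (FreeGroup.freeGroupCongr (optionNeEquiv e))))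

section Basis

variable (σa σb : FreeGroup {x : E // x ≠ e})

/-- `splitBasis_map_inl`: bookkeeping lemma of this construction (see the module docstring). [cite: ZieschangVogtColdewey1980, Prop. 3.2.4 (canonical normal form 3.2.6)] -/
theorem splitBasis_map_inl (x : FreeGroup (GBIndex g (m + 1))) :
    ((sumCongrLeft ((splitConjAut g m a).trans G.β)).trans
      ((splitAut (e := e) (G.β (bwPrefix g m a * bwSuffix g m a)) (G.β (bwPrefix g m a)) σa σb).trans
        (FreeGroup.freeGroupCongr (optionNeEquiv e)))) (FreeGroup.map Sum.inl x) =
      ιE e (G.β (splitConjAut g m a x)) := by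
  rw [MulEquiv.trans_apply, MulEquiv.trans_apply, sumCongrLeft_map_inl]
  exact freeGroupCongr_optionNeEquiv_map_inl_of_fix e _
    (fun y hy => mulGenAut_eq_self_of_mem _ _ _ _ hy) _

/-- `splitBasis_of_inl_castSucc`: bookkeeping lemma of this construction (see the module docstring). [cite: ZieschangVogtColdewey1980, Prop. 3.2.4 (canonical normal form 3.2.6)] -/
@[simp] theorem splitBasis_of_inl_castSucc (i : Fin g) (b : Bool) :
    splitBasis G a σa σb (FreeGroup.of (Sum.inl (i.castSucc, b))) =
      ιE e (G.β (FreeGroup.of (Sum.inl (i, b)))) := by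
  rw [splitBasis, MulEquiv.trans_apply, FreeGroup.freeGroupCongr_apply, FreeGroup.map.of,
    splitIndexEquiv_inl_castSucc, ← FreeGroup.map.of, splitBasis_map_inl, splitConjAut_of_ne a (by simp)]

/-- `splitBasis_of_inr`: bookkeeping lemma of this construction (see the module docstring). [cite: ZieschangVogtColdewey1980, Prop. 3.2.4 (canonical normal form 3.2.6)] -/
@[simp] theorem splitBasis_of_inr (k : Fin m) :
    splitBasis G a σa σb (FreeGroup.of (Sum.inr k)) =
      ιE e (G.β (FreeGroup.of (Sum.inr (a.succAbove k)))) := by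
  rw [splitBasis, MulEquiv.trans_apply, FreeGroup.freeGroupCongr_apply, FreeGroup.map.of,
    splitIndexEquiv_inr, ← FreeGroup.map.of, splitBasis_map_inl,
    splitConjAut_of_ne a (fun h => Fin.succAbove_ne a k (Sum.inr_injective h))]

/-- `splitBasis_of_inl_last_true`: bookkeeping lemma of this construction (see the module docstring). [cite: ZieschangVogtColdewey1980, Prop. 3.2.4 (canonical normal form 3.2.6)] -/
@[simp] theorem splitBasis_of_inl_last_true :
    splitBasis G a σa σb (FreeGroup.of (Sum.inl (Fin.last g, true))) =
      ιE e (G.β (bwPrefix g m a)) * ιE e (G.β (FreeGroup.of (Sum.inr a))) * (ιE e (G.β (bwPrefix g m a)))⁻¹ := by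
  rw [splitBasis, MulEquiv.trans_apply, FreeGroup.freeGroupCongr_apply, FreeGroup.map.of,
    splitIndexEquiv_inl_last_true, ← FreeGroup.map.of, splitBasis_map_inl, splitConjAut_of_inr_self,
    map_mul, map_mul, map_inv, map_mul, map_mul, map_inv]

/-- `splitBasis_of_inl_last_false`: bookkeeping lemma of this construction (see the module docstring). [cite: ZieschangVogtColdewey1980, Prop. 3.2.4 (canonical normal form 3.2.6)] -/
@[simp] theorem splitBasis_of_inl_last_false :
    splitBasis G a σa σb (FreeGroup.of (Sum.inl (Fin.last g, false))) =
      ιE e (G.β (bwPrefix g m a * bwSuffix g m a)) * ιE e σb * FreeGroup.of e * (ιE e σa)⁻¹ *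
        (ιE e (G.β (bwPrefix g m a)))⁻¹ := by
  rw [splitBasis, MulEquiv.trans_apply, FreeGroup.freeGroupCongr_apply, FreeGroup.map.of,
    splitIndexEquiv_inl_last_false, MulEquiv.trans_apply, MulEquiv.trans_apply, sumCongrLeft_of_inr,
    splitAut, mulGenAut_of_self, FreeGroup.freeGroupCongr_apply]
  simp only [map_mul, map_inv, FreeGroup.map.of, optionNeEquiv_inr, FreeGroup.map.comp,
    optionNeEquiv_comp_inl, mul_assoc]

/-- The handle part of the new surface word: old handles, then the new pair. [cite: ZieschangVogtColdewey1980, Prop. 3.2.4 (canonical normal form 3.2.6)] -/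
theorem splitBasis_handleWord :
    splitBasis G a σa σb (handleWord (g + 1) m) =
      ιE e (G.β (handleWord g (m + 1))) *
        (splitBasis G a σa σb (FreeGroup.of (Sum.inl (Fin.last g, true))) *
          splitBasis G a σa σb (FreeGroup.of (Sum.inl (Fin.last g, false))) *
          (splitBasis G a σa σb (FreeGroup.of (Sum.inl (Fin.last g, true))))⁻¹ *
          (splitBasis G a σa σb (FreeGroup.of (Sum.inl (Fin.last g, false))))⁻¹) := by
  rw [handleWord, List.ofFn_succ', List.concat_eq_append, List.prod_append, List.prod_singleton, map_mul]
  congr 1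
  · rw [map_list_prod, List.map_ofFn, handleWord, map_list_prod, map_list_prod, List.map_ofFn, List.map_ofFn]
    congr 1
    exact List.ofFn_inj.mpr (funext fun i => by simp)
  · simp only [map_mul, map_inv]

/-- The boundary part of the new surface word: `prefix · suffix`. [cite: ZieschangVogtColdewey1980, Prop. 3.2.4 (canonical normal form 3.2.6)] -/
theorem splitBasis_boundaryWord :
    splitBasis G a σa σb (boundaryWord (g + 1) m) = ιE e (G.β (bwPrefix g m a * bwSuffix g m a)) := by
  rw [boundaryWord, map_list_prod, List.map_ofFn, ← boundaryWord_succAbove, map_list_prod, map_list_prod,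
    List.map_ofFn, List.map_ofFn]
  congr 1
  exact List.ofFn_inj.mpr (funext fun k => by simp)

end Basis

include hper hhit hp1 hq1 hUa hVl in
/-- A representative of an old free slot other than `a` does not lie on the boundary cycle of
`h` (which is also that of `h̄`). [cite: ZieschangVogtColdewey1980, Prop. 3.2.4 (canonical normal form 3.2.6)] -/
theorem split_not_sameCycle_true {j : Fin (m + 1)} (hj : j ≠ a) :
    ¬ (face ρ).SameCycle (e, true) (dartEmb e (G.rep j.castSucc)) := by
  intro hs
  rcases split_cases hper hhit hp1 hq1 (dartEmb_fst_ne e _) hs with h | h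
  · have h2 : (face (delRot ρ e)).SameCycle (G.rep a.castSucc) (G.rep j.castSucc) := by
      rw [sameCycle_face_delRot_iff]; exact hUa.trans h
    exact hj (Fin.castSucc_injective _ (G.rep_inj _ _ h2)).symm
  · have h2 : (face (delRot ρ e)).SameCycle (G.rep (Fin.last (m + 1))) (G.rep j.castSucc) := by
      rw [sameCycle_face_delRot_iff]; exact hVl.trans h
    exact (Fin.castSucc_lt_last j).ne' (G.rep_inj _ _ h2)

include hhit in
omit [Finite E] [DecidableEq E] in
/-- `split_sameCycle_true_false`: bookkeeping lemma of this construction (see the module docstring). [cite: ZieschangVogtColdewey1980, Prop. 3.2.4 (canonical normal form 3.2.6)] -/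
theorem split_sameCycle_true_false : (face ρ).SameCycle (e, true) (e, false) :=
  hhit ▸ (sameCycle_pow_right (f := face ρ) (n := p + 1)).2 SameCycle.rfl

include hper hhit hp1 hq1 hUa hVl in
/-- Old free slots other than `a` keep their darts, lengths and words. [cite: ZieschangVogtColdewey1980, Prop. 3.2.4 (canonical normal form 3.2.6)] -/
theorem split_others {j : Fin (m + 1)} (hj : j ≠ a) :
    cycleProd (delFace ρ e) letter (dartEmb e (G.rep j.castSucc)) =
        cycleProd (face ρ) letter (dartEmb e (G.rep j.castSucc)) ∧
      ∀ z, (delFace ρ e).SameCycle (dartEmb e (G.rep j.castSucc)) z ↔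
        (face ρ).SameCycle (dartEmb e (G.rep j.castSucc)) z :=
  (others_eq (split_not_sameCycle_true a hper hhit hp1 hq1 G hUa hVl hj)
    (fun h => split_not_sameCycle_true a hper hhit hp1 hq1 G hUa hVl hj
      ((split_sameCycle_true_false hhit).trans h))).2

/-- **The split step.** [cite: ZieschangVogtColdewey1980, Prop. 3.2.4 (canonical normal form 3.2.6)] -/
noncomputable def GeometricBasis.splitStep : GeometricBasis ρ (g + 1) m :=
  let W := split_exists_words a hper hhit hp1 hq1 G hUa hVl
  let σa := W.choose
  let σb := W.choose_spec.choose
  have hU : prodFrom (face ρ) letter (face ρ (e, true)) p =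
      (ιE e σa)⁻¹ * ιE e (G.β (FreeGroup.of (Sum.inr a))) * ιE e σa := W.choose_spec.choose_spec.1
  have hV : prodFrom (face ρ) letter (face ρ (e, false)) q =
      (ιE e σb)⁻¹ * (ιE e (G.β (surfaceWord g (m + 1))))⁻¹ * ιE e σb := W.choose_spec.choose_spec.2
  { β := splitBasis G a σa σb
    rep := Fin.snoc (fun k : Fin m => dartEmb e (G.rep (a.succAbove k).castSucc)) (e, true)
    t := Fin.snoc (fun k : Fin m => ιE e (G.t (a.succAbove k).castSucc)) (ιE e σb)
    rep_surj := by
      intro x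
      by_cases hx : x.1 ≠ e
      · obtain ⟨x', rfl⟩ := exists_dartEmb_eq e hx
        obtain ⟨k', hk'⟩ := G.rep_surj x'
        have hk'' := (sameCycle_face_delRot_iff ρ e _ _).1 hk'
        cases k' using Fin.lastCases with
        | last =>
          refine ⟨Fin.last m, ?_⟩
          simp only [Fin.snoc_last]
          obtain ⟨k, -, hk⟩ := (split_sameCycle_false_iff hper hhit hq1 _).1 (hVl.symm.trans hk'')
          rw [← hk, split_pow_false hhit]
          exact (sameCycle_pow_right (f := face ρ) (n := k + 1 + (p + 1))).2 SameCycle.rfl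
        | cast j =>
          by_cases hja : j = a
          · subst hja
            refine ⟨Fin.last m, ?_⟩
            simp only [Fin.snoc_last]
            obtain ⟨k, -, hk⟩ := (split_sameCycle_true_iff hper hhit hp1 _).1 (hUa.symm.trans hk'')
            rw [← hk]
            exact (sameCycle_pow_right (f := face ρ) (n := k + 1)).2 SameCycle.rfl
          · obtain ⟨k, rfl⟩ := Fin.exists_succAbove_eq hja
            refine ⟨k.castSucc, ?_⟩
            simp only [Fin.snoc_castSucc]
            exact ((split_others a hper hhit hp1 hq1 G hUa hVl (Fin.succAbove_ne a k)).2 _).1 hk''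
      · rw [not_ne_iff] at hx
        rcases x with ⟨x, b⟩
        simp only at hx; subst hx
        refine ⟨Fin.last m, ?_⟩
        simp only [Fin.snoc_last]
        cases b
        · exact split_sameCycle_true_false hhit
        · exact SameCycle.rfl
    rep_inj := by
      have key : ∀ (k : Fin (m + 1)) (l : Fin (m + 1)),
          (face ρ).SameCycle
            ((Fin.snoc (fun k : Fin m => dartEmb e (G.rep (a.succAbove k).castSucc)) (e, true) :
              Fin (m + 1) → Dart E) k)
            ((Fin.snoc (fun k : Fin m => dartEmb e (G.rep (a.succAbove k).castSucc)) (e, true) :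
              Fin (m + 1) → Dart E) l) → (k : ℕ) ≤ l → k = l := by
        intro k l hkl hle
        cases k using Fin.lastCases with
        | last => exact (Fin.le_antisymm (Fin.le_last l) hle).symm
        | cast k =>
          cases l using Fin.lastCases with
          | last =>
            simp at hkl
            exact absurd hkl.symm (split_not_sameCycle_true a hper hhit hp1 hq1 G hUa hVl (Fin.succAbove_ne a k))
          | cast l =>
            simp only [Fin.snoc_castSucc] at hkl
            have h1 := ((split_others a hper hhit hp1 hq1 G hUa hVl (Fin.succAbove_ne a k)).2 _).2 hkl
            rw [← sameCycle_face_delRot_iff] at h1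
            have h2 := G.rep_inj _ _ h1
            simp only [Fin.castSucc_inj] at h2
            rw [Fin.succAbove_right_injective h2]
      intro k l hkl
      rcases le_total (k : ℕ) l with h | h
      · exact key k l hkl h
      · exact (key l k hkl.symm h).symm
    free_eq := by
      intro k
      simp only [Fin.snoc_castSucc, splitBasis_of_inr]
      rw [← (split_others a hper hhit hp1 hq1 G hUa hVl (Fin.succAbove_ne a k)).1,
        ← map_cycleProd_face_delRot, ← G.free_eq (a.succAbove k)]
      simp only [map_mul, map_inv]
    last_eq := by
      simp only [Fin.snoc_last]
      rw [split_cycleProd_eq hper hhit, hU, hV]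
      simp only [surfaceWord, map_mul, splitBasis_handleWord, splitBasis_boundaryWord,
        splitBasis_of_inl_last_true, splitBasis_of_inl_last_false]
      rw [boundaryWord_eq_prefix_mul_suffix a]
      simp only [map_mul]
      group
    card_eq := by
      have h1 := G.card_eq
      have h2 : Nat.card {x : E // x ≠ e} + 1 = Nat.card E := by
        rw [← Nat.card_unique (α := Unit), ← Nat.card_sum]
        exact Nat.card_congr (optionNeEquiv e)
      omega }

/-- The representatives of the split step: old free slots except `a`, then `h` (last).
[cite: ZieschangVogtColdewey1980, Prop. 3.2.4 (canonical normal form 3.2.6)] -/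
theorem GeometricBasis.splitStep_rep :
    (GeometricBasis.splitStep a hper hhit hp1 hq1 G hUa hVl).rep =
      Fin.snoc (fun k : Fin m => dartEmb e (G.rep (a.succAbove k).castSucc)) (e, true) := rfl

end Split

end RibbonGraph

end Literature.GroupTheory.CombinatorialGroupTheory
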